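import Literature.Computability.Cryptography.HallgrenClassGroupLatticeHNF
import Literature.NumberTheory.QuadraticFields.FormIdealsStructure
import Literature.NumberTheory.EllipticCurves.HeegnerPointsClassNumberProofs
import HarnessLib

/-!
# Hallgren 2005 / class numbers under GRH — step Q1a (ideal part): composition of form ideals by
# the Hermite normal form of the product lattice

Topic `Literature/Computability/Cryptography`; proof companion of `HallgrenClassGroup.lean`
(named fact `Hallgren2005_classNumber_qsolvable_of_GRH`). Real definitions (with bodies) and
theorems; no named fact.

In a quadratic ring `R = ℤ ⊕ ℤω`, `ω² = m + tω` (the tree's setting of `FormIdeals.lean`), the form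
ideal of `(A, 2k − t, C)` with `AC = k² − tk − m` is `𝔞 = (A, ω − k) = ℤA ⊕ ℤ(ω − k)`. The product of
two form ideals `𝔞₁ = (a₁, ω − k₁)`, `𝔞₂ = (a₂, ω − k₂)` is the `ℤ`-span of the four products
`a₁a₂, a₁(ω − k₂), a₂(ω − k₁), (ω − k₁)(ω − k₂)`, with coordinates
`(a₁a₂, 0), (−a₁k₂, a₁), (−a₂k₁, a₂), (m + k₁k₂, t − k₁ − k₂)` in the basis `(1, ω)` — a lattice
given by four generators, whose Hermite form `ℤ(g', 0) ⊕ ℤ(x, d)`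
(`LatticeHNF.closure_eq_closure_pair`) yields the COMPOSITION: `d ∣ g'`, `d ∣ x`, and with
`A = g'/d`, `k₃ = −x/d`,

  `𝔞₁ · 𝔞₂ = (d) · (A, ω − k₃)`,  `A ∣ k₃² − t k₃ − m`,  `A > 0`,

so `(A, 2k₃ − t, (k₃² − tk₃ − m)/A)` is a form of the same discriminant whose ideal class is the
product of the classes (`mk0_compIdeal`). This is the composition the class-number algorithm
computes (a handful of extended gcds — `compD`, `compA`, `compK` are the algorithm), in the general
case (no coprimality hypothesis, unlike the tree's united-forms lemma
`span_pair_mul_span_pair_of_isCoprime`); it is Gauss/Dirichlet composition through ideals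
(Cox, *Primes of the form x² + ny²*, Thm. 7.7 and §3.A; Cohen, *A Course in Computational
Algebraic Number Theory*, §5.4.2).

## References

* D. A. Cox, *Primes of the form x² + ny²*, 2nd ed. (2013), §3.A, §7.B Thm. 7.7 [Cox2013].
* H. Cohen, *A Course in Computational Algebraic Number Theory*, GTM 138, §5.4.2 [folklore].
* A. M. Childs, W. van Dam, Rev. Mod. Phys. 82 (2010), §5.7 [ChildsVandam2010].
-/

noncomputable section

open scoped nonZeroDivisors

namespace Literature.Computability.Cryptography.Hallgren2005

namespace Composition

open Module Literature.NumberTheory.QuadraticFields.Quadratic Literature.NumberTheory.EllipticCurves LatticeHNF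

/-! ### The algorithm: integer data of the composition -/

/-- The coordinates, in the basis `(1, ω)`, of the four products generating `𝔞₁𝔞₂`. [folklore] -/
def prodVecs (t m a₁ k₁ a₂ k₂ : ℤ) : List (ℤ × ℤ) :=
  [(a₁ * a₂, 0), (-(a₁ * k₂), a₁), (-(a₂ * k₁), a₂), (m + k₁ * k₂, t - k₁ - k₂)]

/-- The content `d = gcd(a₁, a₂, t − k₁ − k₂)` of the product (second coordinate of the Bezout vector
`w`). [folklore] -/
def compD (t m a₁ k₁ a₂ k₂ : ℤ) : ℤ := (gcdVec (prodVecs t m a₁ k₁ a₂ k₂)).2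

/-- The first coordinate `x` of the Bezout vector `w = (x, d)`. [folklore] -/
def compX (t m a₁ k₁ a₂ k₂ : ℤ) : ℤ := (gcdVec (prodVecs t m a₁ k₁ a₂ k₂)).1

/-- The first coefficient `A = g'/d` of the composed form. [cite: Cox2013, §3.A (composition)] -/
def compA (t m a₁ k₁ a₂ k₂ : ℤ) : ℤ := axisGcd (prodVecs t m a₁ k₁ a₂ k₂) / compD t m a₁ k₁ a₂ k₂

/-- The parameter `k₃ = −x/d` of the composed form (middle coefficient `2k₃ − t`).
[cite: Cox2013, §3.A (composition)] -/
def compK (t m a₁ k₁ a₂ k₂ : ℤ) : ℤ := -(compX t m a₁ k₁ a₂ k₂ / compD t m a₁ k₁ a₂ k₂)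

/-! ### Coordinates in a quadratic ring -/

section Ring

variable {R : Type*} [CommRing R] (b : Basis (Fin 2) ℤ R) (hb : b 0 = 1)
  {t m : ℤ} (hω : b 1 * b 1 = (m : R) + (t : R) * b 1)

/-- The element `x + yω` with coordinates `(x, y)`. [folklore] -/
def toRing (v : ℤ × ℤ) : R := (v.1 : R) + (v.2 : R) * b 1

omit hb in
/-- `toRing` is additive. [folklore] -/
theorem toRing_add (v w : ℤ × ℤ) : toRing b (v + w) = toRing b v + toRing b w := by
  simp only [toRing, Prod.fst_add, Prod.snd_add, Int.cast_add]; ring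

omit hb in
/-- `toRing` commutes with integer scalars. [folklore] -/
theorem toRing_zsmul (n : ℤ) (v : ℤ × ℤ) : toRing b (n • v) = (n : R) * toRing b v := by
  simp only [toRing, Prod.smul_fst, Prod.smul_snd, smul_eq_mul, Int.cast_mul]; ring

/-- `toRing` as a homomorphism of additive groups. [folklore] -/
def toRingHom : ℤ × ℤ →+ R where
  toFun := toRing b
  map_zero' := by simp [toRing]
  map_add' := toRing_add b

omit hb in
/-- `toRingHom` is `toRing`. [folklore] -/
@[simp] theorem toRingHom_apply (v : ℤ × ℤ) : toRingHom b v = toRing b v := rfl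

include hb in
/-- `toRing` is injective (`(1, ω)` is a basis). [folklore] -/
theorem toRing_injective : Function.Injective (toRing b) := by
  intro v w h
  obtain ⟨h1, h2⟩ := intCast_add_intCast_mul_inj b hb h
  exact Prod.ext h1 h2

include hω in
/-- **Multiplication by `ω` in coordinates**: `ω (x + yω) = my + (x + ty) ω`. [folklore] -/
theorem basis_one_mul_toRing (v : ℤ × ℤ) :
    b 1 * toRing b v = toRing b (m * v.2, v.1 + t * v.2) := by
  simp only [toRing, Int.cast_mul, Int.cast_add]
  linear_combination (v.2 : R) * hω

include hω in
/-- The four products, in coordinates: `a₁a₂`, `a₁(ω − k₂)`, `a₂(ω − k₁)`, `(ω − k₁)(ω − k₂)`.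
[folklore] -/
theorem toRing_prodVecs (a₁ k₁ a₂ k₂ : ℤ) :
    (prodVecs t m a₁ k₁ a₂ k₂).map (toRing b) =
      [(a₁ : R) * a₂, (a₁ : R) * (b 1 - k₂), (a₂ : R) * (b 1 - k₁), (b 1 - k₁) * (b 1 - k₂)] := by
  simp only [prodVecs, List.map_cons, List.map_nil, toRing, List.cons.injEq, and_true]
  push_cast
  refine ⟨by ring, by ring, by ring, ?_⟩
  linear_combination (-1 : R) * hω

/-! ### The product ideal is the image of the product lattice -/

include hb hω in
/-- **`𝔞₁𝔞₂` is the `ℤ`-span of the four products** (as a subset of `R`): for form ideals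
`𝔞_i = (a_i, ω − k_i)` with `a_i c_i = k_i² − t k_i − m`,
`𝔞₁ 𝔞₂ = toRing '' ⟨prodVecs⟩`. (`𝔞_i = ℤa_i ⊕ ℤ(ω − k_i)`, `mem_span_pair_iff_of_basis`, and bilinearity.)
[cite: Cox2013, §7.B Thm. 7.7 (ideals as lattices)] -/
theorem coe_mul_eq_image {a₁ k₁ c₁ a₂ k₂ c₂ : ℤ} (hn₁ : a₁ * c₁ = k₁ ^ 2 - t * k₁ - m)
    (hn₂ : a₂ * c₂ = k₂ ^ 2 - t * k₂ - m) :
    ((Ideal.span {(a₁ : R), b 1 - k₁} * Ideal.span {(a₂ : R), b 1 - k₂} : Ideal R) : Set R) =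
      toRing b '' (AddSubgroup.closure {v | v ∈ prodVecs t m a₁ k₁ a₂ k₂}) := by
  set L := prodVecs t m a₁ k₁ a₂ k₂ with hL
  set Λ : AddSubgroup (ℤ × ℤ) := AddSubgroup.closure {v | v ∈ L} with hΛ
  have hv : ∀ v ∈ L, v ∈ Λ := fun v hv => AddSubgroup.subset_closure hv
  have hv₁ : ((a₁ * a₂, 0) : ℤ × ℤ) ∈ Λ := hv _ (by simp [hL, prodVecs])
  have hv₂ : ((-(a₁ * k₂), a₁) : ℤ × ℤ) ∈ Λ := hv _ (by simp [hL, prodVecs])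
  have hv₃ : ((-(a₂ * k₁), a₂) : ℤ × ℤ) ∈ Λ := hv _ (by simp [hL, prodVecs])
  have hv₄ : ((m + k₁ * k₂, t - k₁ - k₂) : ℤ × ℤ) ∈ Λ := hv _ (by simp [hL, prodVecs])
  apply Set.Subset.antisymm
  · intro x hx
    refine Submodule.mul_induction_on (C := fun x => x ∈ toRing b '' (Λ : Set (ℤ × ℤ))) hx ?_ ?_
    · intro y hy z hz
      obtain ⟨u, v, rfl⟩ := (mem_span_pair_iff_of_basis b hb hω hn₁ y).1 hy
      obtain ⟨u', v', rfl⟩ := (mem_span_pair_iff_of_basis b hb hω hn₂ z).1 hz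
      refine ⟨(u * u') • ((a₁ * a₂, 0) : ℤ × ℤ) + (u * v') • ((-(a₁ * k₂), a₁) : ℤ × ℤ) +
        (v * u') • ((-(a₂ * k₁), a₂) : ℤ × ℤ) + (v * v') • ((m + k₁ * k₂, t - k₁ - k₂) : ℤ × ℤ), ?_, ?_⟩
      · exact add_mem (add_mem (add_mem (zsmul_mem hv₁ _) (zsmul_mem hv₂ _)) (zsmul_mem hv₃ _))
          (zsmul_mem hv₄ _)
      · rw [toRing_add, toRing_add, toRing_add, toRing_zsmul, toRing_zsmul, toRing_zsmul, toRing_zsmul]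
        simp only [toRing]
        push_cast
        linear_combination (-((v : R) * v')) * hω
    · rintro y z ⟨u, hu, rfl⟩ ⟨u', hu', rfl⟩
      exact ⟨u + u', add_mem hu hu', toRing_add b u u'⟩
  · rintro x ⟨u, hu, rfl⟩
    have hgen : ∀ v ∈ L, toRing b v ∈
        (Ideal.span {(a₁ : R), b 1 - k₁} * Ideal.span {(a₂ : R), b 1 - k₂} : Ideal R) := by
      intro v hv'
      have hmem : toRing b v ∈ (L.map (toRing b)) := List.mem_map.mpr ⟨v, hv', rfl⟩
      rw [toRing_prodVecs b hω] at hmem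
      have i₁ : (a₁ : R) ∈ Ideal.span {(a₁ : R), b 1 - k₁} := Ideal.subset_span (by simp)
      have i₂ : (b 1 - k₁ : R) ∈ Ideal.span {(a₁ : R), b 1 - k₁} := Ideal.subset_span (by simp)
      have j₁ : (a₂ : R) ∈ Ideal.span {(a₂ : R), b 1 - k₂} := Ideal.subset_span (by simp)
      have j₂ : (b 1 - k₂ : R) ∈ Ideal.span {(a₂ : R), b 1 - k₂} := Ideal.subset_span (by simp)
      simp only [List.mem_cons, List.mem_nil_iff, or_false] at hmem
      rcases hmem with h | h | h | h <;> rw [h]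
      · exact Ideal.mul_mem_mul i₁ j₁
      · exact Ideal.mul_mem_mul i₁ j₂
      · rw [show (a₂ : R) * (b 1 - k₁) = (b 1 - k₁) * a₂ from mul_comm _ _]
        exact Ideal.mul_mem_mul i₂ j₁
      · exact Ideal.mul_mem_mul i₂ j₂
    induction hu using AddSubgroup.closure_induction with
    | mem v hv' => exact hgen v hv'
    | zero => simp [toRing]
    | add v w _ _ hv' hw' => rw [toRing_add]; exact Ideal.add_mem _ hv' hw'
    | neg v _ hv' =>
      rw [show -v = (-1 : ℤ) • v by simp, toRing_zsmul]
      exact Ideal.mul_mem_left _ _ hv'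

include hb hω in
/-- Membership test through coordinates: `toRing u ∈ 𝔞₁𝔞₂ ↔ u ∈ ⟨prodVecs⟩`. [folklore] -/
theorem toRing_mem_mul_iff {a₁ k₁ c₁ a₂ k₂ c₂ : ℤ} (hn₁ : a₁ * c₁ = k₁ ^ 2 - t * k₁ - m)
    (hn₂ : a₂ * c₂ = k₂ ^ 2 - t * k₂ - m) (u : ℤ × ℤ) :
    toRing b u ∈ (Ideal.span {(a₁ : R), b 1 - k₁} * Ideal.span {(a₂ : R), b 1 - k₂} : Ideal R) ↔
      u ∈ AddSubgroup.closure {v | v ∈ prodVecs t m a₁ k₁ a₂ k₂} := by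
  rw [← SetLike.mem_coe, coe_mul_eq_image b hb hω hn₁ hn₂, (toRing_injective b hb).mem_set_image]
  rfl

include hb hω in
/-- **The product lattice is stable under `ω`**: if `u ∈ ⟨prodVecs⟩` then
`(m u₂, u₁ + t u₂) ∈ ⟨prodVecs⟩` (it is an ideal). [folklore] -/
theorem omega_mem {a₁ k₁ c₁ a₂ k₂ c₂ : ℤ} (hn₁ : a₁ * c₁ = k₁ ^ 2 - t * k₁ - m)
    (hn₂ : a₂ * c₂ = k₂ ^ 2 - t * k₂ - m) {u : ℤ × ℤ}
    (hu : u ∈ AddSubgroup.closure {v | v ∈ prodVecs t m a₁ k₁ a₂ k₂}) :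
    ((m * u.2, u.1 + t * u.2) : ℤ × ℤ) ∈ AddSubgroup.closure {v | v ∈ prodVecs t m a₁ k₁ a₂ k₂} := by
  rw [← toRing_mem_mul_iff b hb hω hn₁ hn₂] at hu ⊢
  rw [← basis_one_mul_toRing b hω]
  exact Ideal.mul_mem_left _ _ hu

/-! ### Divisibilities -/

include hb hω in
/-- **`d ∣ x`**: the first coordinate of the Bezout vector `w = (x, d)` is divisible by `d`
(from `ω w ∈ 𝔞₁𝔞₂`, whose second coordinate `x + td` must be a multiple of `d`). [folklore] -/
theorem compD_dvd_compX {a₁ k₁ c₁ a₂ k₂ c₂ : ℤ} (hn₁ : a₁ * c₁ = k₁ ^ 2 - t * k₁ - m)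
    (hn₂ : a₂ * c₂ = k₂ ^ 2 - t * k₂ - m) :
    compD t m a₁ k₁ a₂ k₂ ∣ compX t m a₁ k₁ a₂ k₂ := by
  have hw := gcdVec_mem_closure (prodVecs t m a₁ k₁ a₂ k₂)
  have h := gcdVec_snd_dvd_of_mem_closure _ (omega_mem b hb hω hn₁ hn₂ hw)
  -- `d ∣ x + t d`
  simp only at h
  have h' : compD t m a₁ k₁ a₂ k₂ ∣ compX t m a₁ k₁ a₂ k₂ + t * compD t m a₁ k₁ a₂ k₂ := h
  exact (dvd_add_left (dvd_mul_left _ t)).mp h'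

include hb hω in
/-- **`d ∣ g'`** (from `ω g' ∈ 𝔞₁𝔞₂`). [folklore] -/
theorem compD_dvd_axisGcd {a₁ k₁ c₁ a₂ k₂ c₂ : ℤ} (hn₁ : a₁ * c₁ = k₁ ^ 2 - t * k₁ - m)
    (hn₂ : a₂ * c₂ = k₂ ^ 2 - t * k₂ - m) :
    compD t m a₁ k₁ a₂ k₂ ∣ axisGcd (prodVecs t m a₁ k₁ a₂ k₂) := by
  have hg := axisGcd_mem_closure (prodVecs t m a₁ k₁ a₂ k₂)
  have h := gcdVec_snd_dvd_of_mem_closure _ (omega_mem b hb hω hn₁ hn₂ hg)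
  simpa [compD] using h

/-- `d ≠ 0` when `a₁ ≠ 0` (`d ∣ a₁`). [folklore] -/
theorem compD_ne_zero {t m a₁ k₁ a₂ k₂ : ℤ} (ha₁ : a₁ ≠ 0) : compD t m a₁ k₁ a₂ k₂ ≠ 0 := by
  intro h
  have := gcdVec_snd_dvd (prodVecs t m a₁ k₁ a₂ k₂) (-(a₁ * k₂), a₁) (by simp [prodVecs])
  rw [compD] at h
  rw [h, zero_dvd_iff] at this
  exact ha₁ this

/-- `0 < d` when `a₁ ≠ 0`. [folklore] -/
theorem compD_pos {t m a₁ k₁ a₂ k₂ : ℤ} (ha₁ : a₁ ≠ 0) : 0 < compD t m a₁ k₁ a₂ k₂ :=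
  lt_of_le_of_ne (gcdVec_snd_nonneg _) (Ne.symm (compD_ne_zero ha₁))

/-- On the axis, elements of the product lattice are multiples of `g'` (using `d ≠ 0`). [folklore] -/
theorem axisGcd_dvd_of_mem {t m a₁ k₁ a₂ k₂ : ℤ} (ha₁ : a₁ ≠ 0) {u : ℤ × ℤ}
    (hu : u ∈ AddSubgroup.closure {v | v ∈ prodVecs t m a₁ k₁ a₂ k₂}) (hu0 : u.2 = 0) :
    axisGcd (prodVecs t m a₁ k₁ a₂ k₂) ∣ u.1 := by
  obtain ⟨a, c, rfl⟩ := exists_eq_of_mem_closure _ hu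
  simp only [Prod.snd_add, Prod.smul_snd, smul_eq_mul, mul_zero, zero_add] at hu0
  have hc : c = 0 := by
    rcases mul_eq_zero.mp hu0 with h | h
    · exact h
    · exact absurd h (compD_ne_zero (t := t) (m := m) (k₁ := k₁) (a₂ := a₂) (k₂ := k₂) ha₁)
  subst hc
  simp

/-- `0 < g'` when `a₁ a₂ ≠ 0` (`g' ∣ a₁a₂`, `g' ≥ 0`). [folklore] -/
theorem axisGcd_pos {t m a₁ k₁ a₂ k₂ : ℤ} (ha₁ : a₁ ≠ 0) (ha₂ : a₂ ≠ 0) :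
    0 < axisGcd (prodVecs t m a₁ k₁ a₂ k₂) := by
  have h := axisGcd_dvd_of_mem (t := t) (m := m) (k₁ := k₁) (k₂ := k₂) ha₁
    (AddSubgroup.subset_closure (by simp [prodVecs] : ((a₁ * a₂, 0) : ℤ × ℤ) ∈ {v | v ∈ prodVecs t m a₁ k₁ a₂ k₂})) rfl
  simp only at h
  refine lt_of_le_of_ne (axisGcd_nonneg _) (fun h0 => ?_)
  rw [← h0, zero_dvd_iff] at h
  exact mul_ne_zero ha₁ ha₂ h

include hb hω in
/-- **`A = g'/d > 0`, exactly: `g' = d A`.** [folklore] -/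
theorem axisGcd_eq_compD_mul_compA {a₁ k₁ c₁ a₂ k₂ c₂ : ℤ} (hn₁ : a₁ * c₁ = k₁ ^ 2 - t * k₁ - m)
    (hn₂ : a₂ * c₂ = k₂ ^ 2 - t * k₂ - m) :
    axisGcd (prodVecs t m a₁ k₁ a₂ k₂) = compD t m a₁ k₁ a₂ k₂ * compA t m a₁ k₁ a₂ k₂ := by
  rw [compA, Int.mul_ediv_cancel' (compD_dvd_axisGcd b hb hω hn₁ hn₂)]

include hb hω in
/-- **`x = −d k₃`.** [folklore] -/
theorem compX_eq {a₁ k₁ c₁ a₂ k₂ c₂ : ℤ} (hn₁ : a₁ * c₁ = k₁ ^ 2 - t * k₁ - m)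
    (hn₂ : a₂ * c₂ = k₂ ^ 2 - t * k₂ - m) :
    compX t m a₁ k₁ a₂ k₂ = -(compD t m a₁ k₁ a₂ k₂ * compK t m a₁ k₁ a₂ k₂) := by
  rw [compK, mul_neg, neg_neg, Int.mul_ediv_cancel' (compD_dvd_compX b hb hω hn₁ hn₂)]

include hb hω in
/-- **`A ∣ k₃² − t k₃ − m`**: the composed ideal `(A, ω − k₃)` is a form ideal (from
`ω · w ∈ 𝔞₁𝔞₂`: `ω w − (t − k₃) w = (d (m + t k₃ − k₃²), 0)` lies on the axis, so `dA ∣ d(…)`). [folklore] -/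
theorem compA_dvd {a₁ k₁ c₁ a₂ k₂ c₂ : ℤ} (ha₁ : a₁ ≠ 0) (hn₁ : a₁ * c₁ = k₁ ^ 2 - t * k₁ - m)
    (hn₂ : a₂ * c₂ = k₂ ^ 2 - t * k₂ - m) :
    compA t m a₁ k₁ a₂ k₂ ∣ compK t m a₁ k₁ a₂ k₂ ^ 2 - t * compK t m a₁ k₁ a₂ k₂ - m := by
  set L := prodVecs t m a₁ k₁ a₂ k₂ with hL
  set d := compD t m a₁ k₁ a₂ k₂ with hd
  set x := compX t m a₁ k₁ a₂ k₂ with hx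
  set A := compA t m a₁ k₁ a₂ k₂ with hA
  set k₃ := compK t m a₁ k₁ a₂ k₂ with hk₃
  have hw : gcdVec L = (x, d) := Prod.ext rfl rfl
  have hwmem : ((x, d) : ℤ × ℤ) ∈ AddSubgroup.closure {v | v ∈ L} := hw ▸ gcdVec_mem_closure L
  have homega := omega_mem b hb hω hn₁ hn₂ hwmem
  simp only at homega
  -- the axis element `ω w − (t − k₃) w`
  have haxis : ((m * d, x + t * d) : ℤ × ℤ) - (t - k₃) • ((x, d) : ℤ × ℤ) ∈ AddSubgroup.closure {v | v ∈ L} :=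
    sub_mem homega (zsmul_mem hwmem _)
  have hxd : x = -(d * k₃) := compX_eq b hb hω hn₁ hn₂
  have hsnd : (((m * d, x + t * d) : ℤ × ℤ) - (t - k₃) • ((x, d) : ℤ × ℤ)).2 = 0 := by
    simp only [Prod.snd_sub, Prod.smul_snd, smul_eq_mul, hxd]; ring
  have hdvd := axisGcd_dvd_of_mem (t := t) (m := m) (k₁ := k₁) (k₂ := k₂) ha₁ haxis hsnd
  simp only [Prod.fst_sub, Prod.smul_fst, smul_eq_mul, hxd] at hdvd
  rw [← hL, axisGcd_eq_compD_mul_compA b hb hω hn₁ hn₂, ← hd, ← hA] at hdvd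
  have hd0 : d ≠ 0 := compD_ne_zero ha₁
  -- `d A ∣ d (m + t k₃ − k₃²)`
  have h1 : d * A ∣ d * (m + t * k₃ - k₃ ^ 2) := by
    have : m * d - (t - k₃) * -(d * k₃) = d * (m + t * k₃ - k₃ ^ 2) := by ring
    rwa [this] at hdvd
  have h2 : A ∣ m + t * k₃ - k₃ ^ 2 := (mul_dvd_mul_iff_left hd0).mp h1
  have h3 : k₃ ^ 2 - t * k₃ - m = -(m + t * k₃ - k₃ ^ 2) := by ring
  rw [h3]
  exact (dvd_neg).mpr h2

/-! ### The composition identity -/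

include hb hω in
/-- **Composition of form ideals**: `𝔞₁ · 𝔞₂ = (d) · (A, ω − k₃)` with `d = compD`, `A = compA`,
`k₃ = compK` (Gauss composition through ideals; Cox Thm. 7.7 / §3.A, Cohen §5.4.2, here in the
general case via the Hermite form of the product lattice). [cite: Cox2013, §7.B Thm. 7.7 and §3.A] -/
theorem mul_eq_span_singleton_mul {a₁ k₁ c₁ a₂ k₂ c₂ : ℤ} (ha₁ : a₁ ≠ 0)
    (hn₁ : a₁ * c₁ = k₁ ^ 2 - t * k₁ - m) (hn₂ : a₂ * c₂ = k₂ ^ 2 - t * k₂ - m) :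
    Ideal.span {(a₁ : R), b 1 - k₁} * Ideal.span {(a₂ : R), b 1 - k₂} =
      Ideal.span {(compD t m a₁ k₁ a₂ k₂ : R)} *
        Ideal.span {(compA t m a₁ k₁ a₂ k₂ : R), b 1 - compK t m a₁ k₁ a₂ k₂} := by
  set L := prodVecs t m a₁ k₁ a₂ k₂ with hL
  set d := compD t m a₁ k₁ a₂ k₂ with hd
  set x := compX t m a₁ k₁ a₂ k₂ with hx
  set A := compA t m a₁ k₁ a₂ k₂ with hA
  set k₃ := compK t m a₁ k₁ a₂ k₂ with hk₃
  obtain ⟨C₃, hC₃⟩ := compA_dvd b hb hω ha₁ hn₁ hn₂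
  have hn₃ : A * C₃ = k₃ ^ 2 - t * k₃ - m := hC₃.symm
  have hw : gcdVec L = (x, d) := Prod.ext rfl rfl
  have hg : axisGcd L = d * A := axisGcd_eq_compD_mul_compA b hb hω hn₁ hn₂
  have hxd : x = -(d * k₃) := compX_eq b hb hω hn₁ hn₂
  apply SetLike.coe_injective
  rw [coe_mul_eq_image b hb hω hn₁ hn₂, ← hL, closure_eq_closure_pair L, hw, hg]
  ext y
  constructor
  · rintro ⟨u, hu, rfl⟩
    obtain ⟨p, q, rfl⟩ := AddSubgroup.mem_closure_pair.mp hu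
    rw [SetLike.mem_coe, Ideal.mem_span_singleton_mul]
    refine ⟨(p * A : ℤ) + (q : R) * (b 1 - k₃), ?_, ?_⟩
    · exact (mem_span_pair_iff_of_basis b hb hω hn₃ _).2 ⟨p, q, by push_cast; ring⟩
    · rw [toRing_add, toRing_zsmul, toRing_zsmul, hxd]
      simp only [toRing]
      push_cast
      ring
  · intro hy
    rw [SetLike.mem_coe, Ideal.mem_span_singleton_mul] at hy
    obtain ⟨z, hz, rfl⟩ := hy
    obtain ⟨p, q, rfl⟩ := (mem_span_pair_iff_of_basis b hb hω hn₃ z).1 hz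
    refine ⟨p • ((d * A, 0) : ℤ × ℤ) + q • ((x, d) : ℤ × ℤ), ?_, ?_⟩
    · exact AddSubgroup.mem_closure_pair.mpr ⟨p, q, rfl⟩
    · rw [toRing_add, toRing_zsmul, toRing_zsmul, hxd]
      simp only [toRing]
      push_cast
      ring

include hb hω in
/-- **The composed data is a form**: `A > 0`, `A C₃ = k₃² − tk₃ − m` for some `C₃`, i.e.
`(A, 2k₃ − t, C₃)` has discriminant `t² + 4m`. [cite: Cox2013, §3.A (composition)] -/
theorem compA_pos {a₁ k₁ c₁ a₂ k₂ c₂ : ℤ} (ha₁ : a₁ ≠ 0) (ha₂ : a₂ ≠ 0)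
    (hn₁ : a₁ * c₁ = k₁ ^ 2 - t * k₁ - m) (hn₂ : a₂ * c₂ = k₂ ^ 2 - t * k₂ - m) :
    0 < compA t m a₁ k₁ a₂ k₂ := by
  have hg := axisGcd_pos (t := t) (m := m) (k₁ := k₁) (k₂ := k₂) ha₁ ha₂
  rw [axisGcd_eq_compD_mul_compA b hb hω hn₁ hn₂] at hg
  exact pos_of_mul_pos_right hg (compD_pos ha₁).le

/-- The discriminant of `(A, 2k − t, C)` with `AC = k² − tk − m` is `t² + 4m`. [folklore] -/
theorem disc_eq_of_norm_eq {A k C t m : ℤ} (hn : A * C = k ^ 2 - t * k - m) :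
    (2 * k - t) ^ 2 - 4 * A * C = t ^ 2 + 4 * m := by
  linear_combination (-4 : ℤ) * hn

end Ring

/-! ### Classes -/

section Classes

variable {K : Type*} [Field K] [NumberField K] (b : Basis (Fin 2) ℤ (NumberField.RingOfIntegers K))
  (hb : b 0 = 1) {t m : ℤ}
  (hω : b 1 * b 1 = (m : NumberField.RingOfIntegers K) + (t : NumberField.RingOfIntegers K) * b 1)

include hω in
/-- **The class of the composed form ideal is the product of the classes** (in `Cl(𝓞_K)`):
`[(A, ω − k₃)] = [(a₁, ω − k₁)] · [(a₂, ω − k₂)]`, since `𝔞₁𝔞₂ = (d) · 𝔞₃`. [cite: Cox2013, §7.B Thm. 7.7 (C(d_K) ≅ C(𝒪_K))] -/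
theorem mk0_mul_mk0_eq {a₁ k₁ c₁ a₂ k₂ c₂ : ℤ} (ha₁ : 0 < a₁) (ha₂ : 0 < a₂)
    (hn₁ : a₁ * c₁ = k₁ ^ 2 - t * k₁ - m) (hn₂ : a₂ * c₂ = k₂ ^ 2 - t * k₂ - m) :
    ClassGroup.mk0 ⟨Ideal.span {(a₁ : NumberField.RingOfIntegers K), b 1 - k₁},
        span_pair_mem_nonZeroDivisors b hb ha₁.ne' _⟩ *
      ClassGroup.mk0 ⟨Ideal.span {(a₂ : NumberField.RingOfIntegers K), b 1 - k₂},
        span_pair_mem_nonZeroDivisors b hb ha₂.ne' _⟩ =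
      ClassGroup.mk0 ⟨Ideal.span {(compA t m a₁ k₁ a₂ k₂ : NumberField.RingOfIntegers K),
          b 1 - compK t m a₁ k₁ a₂ k₂},
        span_pair_mem_nonZeroDivisors b hb (compA_pos b hb hω ha₁.ne' ha₂.ne' hn₁ hn₂).ne' _⟩ := by
  rw [← map_mul, ClassGroup.mk0_eq_mk0_iff]
  have hd0 : (compD t m a₁ k₁ a₂ k₂ : NumberField.RingOfIntegers K) ≠ 0 := fun h =>
    compD_ne_zero (t := t) (m := m) (k₁ := k₁) (a₂ := a₂) (k₂ := k₂) ha₁.ne' (intCast_eq_zero_of_basis b hb h)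
  refine ⟨1, (compD t m a₁ k₁ a₂ k₂ : NumberField.RingOfIntegers K), one_ne_zero, hd0, ?_⟩
  rw [Ideal.span_singleton_one, Ideal.top_mul]
  exact mul_eq_span_singleton_mul b hb hω ha₁.ne' hn₁ hn₂

end Classes

end Composition

end Literature.Computability.Cryptography.Hallgren2005

end
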